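import Summits.QuantumFields.BalabanUV.Beta.EriceFlowEnclosureB12AsPrintedWitness
import Literature.MathematicalPhysics.QuantumFieldTheory.Balaban1983to89.Beta.AveragedAFCarrier

/-!
# Beta / EriceFlowEnclosureB12AsPrintedAvgAFWitness — the CAP end-grade carrier does NOT give the LITERAL Theorem 2 on the as-printed carrier of [I]:
# an oscillating toy setting of [I] (β_{k+1} = 1 + 2(−1)^k: slope 1, defect 2) satisfying ALL of `B12BetaAsPrinted`'s typed content, `BetaAvgAFH 1 2 γ`,
# continuity and the printed-type bound — and `¬ Theorem2Statement` (β-flow team, prover 2, unit `b2b-balaban-beta-bflow-p2`, gen 40; ROW AP-I × crew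
# CAP's END grade, lower half; companion of `…B12AsPrintedAvgAF` §2 (what the carrier DOES give: the first sentence + (0.20) + (0.31) up to the defect);
# toolkit: prover 1's `…B12AsPrintedWitness`, the history-level witness `AveragedAFCarrier.Osc.betaO`)

HONEST FRAMING (page 1 of everything the β sub-cell writes): discharging `BetaPertH` makes Bałaban's UV stability UNCONDITIONAL — a
real constructive-QFT result; it is NOT the continuum limit and NOT the Clay problem.  HONEST DEPENDENCY (cell reorg 2026-08-19,
verbatim): «continuum YM on T⁴ ⇐ BetaPertH ∧ nine spine estimates (0/9 proved); BetaPertH ⇐ (D1) ∧ (D4) ∧ CAP+tail; G-an2-4 gates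
asym, D1 and NE2/3/4.»  THIS MODULE DISCHARGES NOTHING: it builds ONE TOY setting of the statement-exact typing of [I] = [Balaban1987RG1]
(`B12BetaAsPrinted`, p537882 ✓) INSIDE AN EXISTENCE PROOF (def-free), after prover 1's `afToy_exists` and part 5's `antiFreeToy_exists`: L = 13; the
β-functions ARE the tree's oscillating history-free family `AveragedAFCarrier.Osc.betaO 1 2` (β_{k+1} = 1 + 2(−1)^k = 3, −1, 3, −1, …: averaged asymptotic
freedom with slope 1 and defect 2, `Osc.avgAFH`; every second step runs the wrong way); kernels β_{j+1}·Re Q_{νμ}, pol F := F(1)·Re Qᵀ, log Z ≡ 0,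
𝐄_int = 𝐄 ≡ β_{j+1}, E₀ = 3; runs = the forward solutions of (0.20).  The toy is OURS; nothing of Bałaban's objects or of [I]'s claims is asserted.

WHAT THIS FILE PROVES (0 sorry, 0 def):
§1 `abs_osc_le` (|1 + 2(−1)^j| ≤ 3); `oscToy_exists` — the toy satisfies `StandingHypotheses ∧ Definitions ∧ Conclusions` of [I] as typed, `S.β = Osc.betaO 1 2`,
   runs = forward solutions.
§2 **`not_theorem2Statement_oscToy`** — for every setting whose runs are the forward solutions of (0.20) with β_2 = −1 (in [I]'s sign) at the SECOND step:
   `¬ Theorem2Statement S hL` — at ε = L⁻² (K = 2) the run ending at g has `1∕g_1² = 1∕g² − 1`, against (0.31)'s left inequality at k = 1.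
§3 **`avgAF_carrier_not_theorem2`** — ∃ S hH: `Definitions ∧ Conclusions ∧ B12BetaAsPrinted S ∧ (∀ γ, BetaAvgAFH 1 2 γ S.β ∧ BetaContH γ S.β ∧ BetaUpperH 3 γ S.β) ∧
   ¬Theorem2Statement S hL`; hence **`not_theorem2Statement_of_avgAFH`**: the schema «`Definitions` + continuity + upper bound + `BetaAvgAFH s D γ₀` (s > 0)
   ⟹ Theorem 2 on [I]'s carrier» is FALSE — the END grade buys the first sentence and (0.31) UP TO THE DEFECT (part 4 `firstSentence_of_avgAFH`), not
   (0.31) at every k; the history-level companion is `AveragedAFCarrier.Osc.literal_carrier_outside_gloss2`.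
NOT CLAIMED: that the toy resembles Bałaban's objects; `BetaAvgAFH` or any interface field for the construction; Theorem 2; `BetaPertH`; continuum; Clay.
-/

namespace Summit.QuantumFields.BalabanUV.Beta.EriceFlowEnclosureB12AsPrintedAvgAFWitness

open Literature.MathematicalPhysics.QuantumFieldTheory.GawedzkiKupiainen1985.PeriodicGleason (Pt delta ExpBound wt wt_pos)
open Literature.MathematicalPhysics.QuantumFieldTheory.Balaban1983to89
open Literature.MathematicalPhysics.QuantumFieldTheory.Balaban1983to89.B12Rep537 (wilsonQ MQ MQ_nonneg)
open Literature.MathematicalPhysics.QuantumFieldTheory.Balaban1983to89.B12BetaAsPrinted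
open Literature.MathematicalPhysics.QuantumFieldTheory.Balaban1983to89.FlowStep (prefixOf BetaContH BetaUpperH)
open Literature.MathematicalPhysics.QuantumFieldTheory.Balaban1983to89.Beta.AveragedAFCarrier
open Summit.QuantumFields.BalabanUV.Beta.EriceFlowEnclosureB12AsPrintedMarginal
open Summit.QuantumFields.BalabanUV.Beta.EriceFlowEnclosureB12AsPrintedWitness
open Summit.QuantumFields.BalabanUV.Beta.EriceFlowEnclosureB12AsPrintedUpper (tunedRuns_of_theorem2Statement)

noncomputable section

/-! ## §1 The oscillating toy -/

/-- `|1 + 2(−1)^j| ≤ 3`. [folklore] -/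
theorem abs_osc_le (j : ℕ) : |1 + 2 * (-1 : ℝ) ^ j| ≤ 3 := by
  rcases neg_one_pow_eq_or ℝ j with h | h <;> rw [h] <;> norm_num

/-- The values of the tree's oscillating family: `Osc.betaO 1 2 k v = 1 + 2(−1)^k`. [folklore] -/
theorem betaO_apply (k : ℕ) (v : Fin (k + 1) → ℝ) : Osc.betaO 1 2 k v = 1 + 2 * (-1 : ℝ) ^ k := rfl

/-- **THE OSCILLATING TOY.**  L = 13; `S.β = Osc.betaO 1 2` (β_{k+1} = 1 + 2(−1)^k); kernels Π_{j+1,μν} := β_{j+1}·Re Q_{νμ}; pol F := F(1)·Re Qᵀ with log Z ≡ 0 and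
𝐄_int = 𝐄 := β_{j+1}; (1.18)'s slot := «|F(1)| ≤ E», E₀ = 3, δ₁ = 1, C510 = MQ(1, 4), C544 = 1; runs = the forward solutions of (0.20).  It satisfies
`StandingHypotheses ∧ Definitions ∧ Conclusions` of [I] as typed (prover 1's toy-kernel lemmas with the step-dependent constant c := 1 + 2(−1)^j). [folklore] -/
theorem oscToy_exists : ∃ S : Setting,
    S.β = Osc.betaO 1 2 ∧ S.L = 13 ∧
    (∀ P k, S.cpl P k = Nat.rec (motive := fun _ => ℝ) P.g0
      (fun k g => 1 / Real.sqrt (1 / g ^ 2 - (1 + 2 * (-1 : ℝ) ^ k))) k) ∧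
    StandingHypotheses S ∧ Definitions S ∧ Conclusions S := by
  -- `Setting` fields in order: L, groupScope, ε₀, cpl, β, γ, M, κ, Cfg, one, logZ, Eint, Ebold, repr437, α₀, α₁, E₀, Mκ, pol, polIV, κ₀,
  -- indAss, ε₁, altCutoff266, logN2, δ₀, δ₁, C510, C544 (anonymous constructor; as in prover 1's `zeroToy_exists` ∕ `afToy_exists`).
  refine ⟨⟨13, True, 1,
      fun P k => Nat.rec (motive := fun _ => ℝ) P.g0
        (fun k g => 1 / Real.sqrt (1 / g ^ 2 - (1 + 2 * (-1 : ℝ) ^ k))) k,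
      Osc.betaO 1 2, 1, 1, 1, fun _ => Unit, fun _ => (), fun _ _ => 0,
      fun j p _ => (1 + 2 * (-1 : ℝ) ^ j),
      fun j p _ => (1 + 2 * (-1 : ℝ) ^ j),
      fun _ F E => |F ()| ≤ E, 1, 1, 3, fun _ => 1,
      fun _ F => fun μ ν x => F () * (wilsonQ ν μ x).re,
      fun j p => fun μ ν x => (1 + 2 * (-1 : ℝ) ^ j) * (wilsonQ ν μ x).re, 1,
      fun _ _ => True, 1, True, fun j p => (1 + 2 * (-1 : ℝ) ^ j), 1, 1, MQ 1 4, 1⟩,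
    rfl, rfl, fun _ _ => rfl, ?_, ?_, ?_⟩
  · exact { hL := ⟨by decide, by norm_num⟩, hG := trivial, hκ₀ := by norm_num, hMκ := by norm_num, hγ := by norm_num,
            hε₀ := by norm_num, hε₁ := by norm_num, hα₀ := by norm_num, hα₁ := by norm_num, hκ := by norm_num,
            hM := by norm_num }
  · refine { d018 := fun P => rfl, d020 := ?_, d13 := ?_, d213 := ?_, d214 := ?_, d120 := ?_, d120split := ?_,
             d121 := ?_, d122 := ?_ }
    · intro P k _ _ hrhs
      exact natRec_run_step P.g0 (fun (k : ℕ) (_ : ℝ) => 1 + 2 * (-1 : ℝ) ^ k) k hrhs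
    · intro j p U; simp
    · intro k p p' _ _; rfl
    · intro k p; rfl
    · intro j p; rfl
    · intro j p; funext μ ν x; simp
    · intro j p
      refine ⟨fun σ μ ν x => ?_, fun ε hε μ ν z => reflect_toyKernel _ hε μ ν z, fun μ ν z => ?_⟩
      · show (1 + 2 * (-1 : ℝ) ^ j) * (wilsonQ (σ ν) (σ μ) (x ∘ σ.symm)).re =
          (1 + 2 * (-1 : ℝ) ^ j) * (wilsonQ ν μ x).re
        rw [wilsonQ_perm]
      · show (1 + 2 * (-1 : ℝ) ^ j) * (wilsonQ ν μ z).re =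
          (1 + 2 * (-1 : ℝ) ^ j) * (wilsonQ μ ν (-z)).re
        rw [wilsonQ_neg_transpose ν μ z]
    · intro j p _ μ ν hμν
      exact ⟨(fourier_toyKernel hμν _).symm, (secondMoment_toyKernel hμν _).symm⟩
  · refine { c13 := fun _ _ _ _ => trivial, c118 := fun _ _ j _ s _ => ⟨?_, ?_⟩, c264 := ?_, c510 := ?_, c537 := ?_ }
    · show |(1 + 2 * (-1 : ℝ) ^ j)| ≤ 3
      exact abs_osc_le j
    · show |(1 + 2 * (-1 : ℝ) ^ j)| ≤ 3
      exact abs_osc_le j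
    · intro P _ j _
      refine ⟨fun n => ?_, fun _ => ?_, fun n => ⟨3, fun s _ => ?_⟩⟩
      · show ContDiffOn ℝ n (fun _ : ℝ => (1 + 2 * (-1 : ℝ) ^ j)) _; exact contDiffOn_const
      · show AnalyticOn ℝ (fun _ : ℝ => (1 + 2 * (-1 : ℝ) ^ j)) _; exact analyticOn_const
      · show ‖iteratedDerivWithin n (fun _ : ℝ => (1 + 2 * (-1 : ℝ) ^ j)) _ s‖ ≤ 3
        rw [iteratedDerivWithin_const]; split_ifs
        · simpa using abs_osc_le j
        · simp
    · refine ⟨by norm_num, fun j F E hF μ ν x => ?_⟩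
      have hF' : |F ()| ≤ E := hF
      have hd := decay510_toyKernel (d := 4) (F ()) μ ν x
      show |F () * (wilsonQ ν μ x).re| ≤ MQ 1 4 * E * Real.exp (-1 * B12Sec2to5.l1 x)
      calc |F () * (wilsonQ ν μ x).re| ≤ |F ()| * MQ 1 4 * Real.exp (-1 * B12Sec2to5.l1 x) := hd
        _ ≤ E * MQ 1 4 * Real.exp (-1 * B12Sec2to5.l1 x) :=
            mul_le_mul_of_nonneg_right (mul_le_mul_of_nonneg_right hF' (MQ_nonneg 1 4)) (Real.exp_pos _).le
        _ = MQ 1 4 * E * Real.exp (-1 * B12Sec2to5.l1 x) := by ring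
    · intro P _ j _ s _ μ ν
      by_cases hμν : μ = ν
      · subst hμν
        refine ⟨fun _ _ => 0, fun x => ?_, fun w y => ?_⟩
        · show (((((1 + 2 * (-1 : ℝ) ^ j)) * (wilsonQ μ μ x).re : ℝ)) : ℂ) -
            (((1 + 2 * (-1 : ℝ) ^ j) : ℝ) : ℂ) * wilsonQ μ μ x =
            ∑ w, diffWord w (fun _ : Pt 4 => (0 : ℂ)) x
          simp only [diffWord_zero, Finset.sum_const_zero]
          push_cast
          rw [wilsonQ_re_coe, sub_self]
        · show ‖(0 : ℂ)‖ ≤ 1 * 3 * wt (1 / 2) y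
          rw [norm_zero]; exact mul_nonneg (by norm_num) (le_of_lt (wt_pos _ _))
      · obtain ⟨rem, hrep, hdec⟩ := rep537_toyKernel (d := 4) hμν ((1 + 2 * (-1 : ℝ) ^ j)) (1 / 2)
        exact ⟨rem, hrep, fun w => (hdec w).mono ((abs_osc_le j).trans (by norm_num))⟩


/-! ## §2 Theorem 2 as typed fails for the toy: the second step runs the wrong way -/

/-- **[I] THEOREM 2 AS TYPED FAILS when the runs are the forward solutions of (0.20) with β_{k+1} = 1 + 2(−1)^k** (β_2 = −1 at the second step): at K = 2
(ε = L⁻²) a run ending at g_2 = g has `1∕g_1² = 1∕g² − 1`, while (0.31)'s left inequality at k = 1 demands `1∕g² + β·ln L ≤ 1∕g_1²` with β > 0.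
[cite: Balaban1987RG1, Thm 2 (0.31) p.259 with (0.20) p.256] -/
theorem not_theorem2Statement_oscToy {S : Setting}
    (hcpl : ∀ P k, S.cpl P k = Nat.rec (motive := fun _ => ℝ) P.g0
      (fun k g => 1 / Real.sqrt (1 / g ^ 2 - (1 + 2 * (-1 : ℝ) ^ k))) k)
    {hL : Odd S.L ∧ 1 < S.L} : ¬ Theorem2Statement S hL := by
  intro h
  obtain ⟨γ₀, hγ₀, hγ⟩ := tunedRuns_of_theorem2Statement h 0
  obtain ⟨g₁, hg₁, hg⟩ := hγ γ₀ hγ₀ le_rfl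
  obtain ⟨β, β', hβ, -, hK⟩ := hg g₁ hg₁ le_rfl
  obtain ⟨g₀, hI, hend, hD⟩ := hK 2
  have hlog : 0 < Real.log (S.L : ℝ) := Real.log_pos (by exact_mod_cast hL.2)
  have h1 := (hD 1 (by norm_num)).1
  -- the forward step at k = 1: 1/g_1² = 1/g_2² + β_2, β_2 = 1 + 2(−1)^1 = −1
  have hrhs : 0 < 1 / (Nat.rec (motive := fun _ => ℝ) g₀ (fun k g => 1 / Real.sqrt (1 / g ^ 2 - (1 + 2 * (-1 : ℝ) ^ k))) 1 : ℝ) ^ 2 -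
      (fun (k : ℕ) (_ : ℝ) => 1 + 2 * (-1 : ℝ) ^ k) 1
        (Nat.rec (motive := fun _ => ℝ) g₀ (fun k g => 1 / Real.sqrt (1 / g ^ 2 - (1 + 2 * (-1 : ℝ) ^ k))) 1 : ℝ) := by
    show 0 < 1 / (Nat.rec (motive := fun _ => ℝ) g₀ (fun k g => 1 / Real.sqrt (1 / g ^ 2 - (1 + 2 * (-1 : ℝ) ^ k))) 1 : ℝ) ^ 2 -
      (1 + 2 * (-1 : ℝ) ^ 1)
    have : 0 ≤ 1 / (Nat.rec (motive := fun _ => ℝ) g₀ (fun k g => 1 / Real.sqrt (1 / g ^ 2 - (1 + 2 * (-1 : ℝ) ^ k))) 1 : ℝ) ^ 2 := by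
      positivity
    simp only [pow_one]
    linarith
  have hstep := (natRec_run_step g₀ (fun (k : ℕ) (_ : ℝ) => 1 + 2 * (-1 : ℝ) ^ k) 1 hrhs).2
  have e1 : (Nat.rec (motive := fun _ => ℝ) g₀ (fun k g => 1 / Real.sqrt (1 / g ^ 2 - (1 + 2 * (-1 : ℝ) ^ k))) 1 : ℝ) =
      S.cpl ⟨2, 0, g₀⟩ 1 := (hcpl ⟨2, 0, g₀⟩ 1).symm
  have e2 : (Nat.rec (motive := fun _ => ℝ) g₀ (fun k g => 1 / Real.sqrt (1 / g ^ 2 - (1 + 2 * (-1 : ℝ) ^ k))) (1 + 1) : ℝ) = g₁ := by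
    rw [← hend, hcpl]
    rfl
  rw [e1, e2] at hstep
  simp only [pow_one] at hstep
  simp only [Nat.cast_ofNat, Nat.cast_one] at h1
  linarith [mul_pos hβ hlog]

/-! ## §3 The END-grade carrier does not give the literal Theorem 2 -/

/-- **THE END-GRADE CARRIER, WITH [I]'s WHOLE TYPED CONTENT, DOES NOT GIVE THE LITERAL THEOREM 2 ON THE CARRIER.**  There is a setting of [I] as typed with
`StandingHypotheses ∧ Definitions ∧ Conclusions` (hence `B12BetaAsPrinted S`) whose β-functions satisfy, on EVERY box family ]0, γ]^{k+1}: `BetaAvgAFH 1 2 γ S.β`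
(averaged asymptotic freedom, slope 1, defect 2), joint continuity and the printed-type bound `β ≤ 3` — and `¬ Theorem2Statement S hL`.  What these hypotheses
DO give is part 4's `firstSentence_of_avgAFH` (the first sentence, (0.20), and (0.31) up to the defect). [cite: Balaban1987RG1, Thm 2 (0.31) p.259] -/
theorem avgAF_carrier_not_theorem2 :
    ∃ (S : Setting) (hH : StandingHypotheses S), Definitions S ∧ Conclusions S ∧ B12BetaAsPrinted S ∧
      (∀ γ : ℝ, BetaAvgAFH 1 2 γ S.β ∧ BetaContH γ S.β ∧ BetaUpperH 3 γ S.β) ∧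
      ¬ Theorem2Statement S (hL_of_standing hH) := by
  obtain ⟨S, hβ, -, hcpl, hH, hD, hC⟩ := oscToy_exists
  refine ⟨S, hH, hD, hC, fun _ _ => hC, fun γ => ?_, not_theorem2Statement_oscToy hcpl⟩
  obtain ⟨hc, hu, -⟩ := Osc.cont_and_bounds (s := (1 : ℝ)) (c := 2) (by norm_num) (by norm_num) γ
  rw [hβ]
  exact ⟨Osc.avgAFH 1 γ (by norm_num), hc, by norm_num at hu; exact hu⟩

/-- **Hence the schema «`Definitions` + continuity + upper bound + `BetaAvgAFH s D γ₀` with s > 0 ⟹ Theorem 2 on [I]'s carrier» is FALSE**: the END grade buys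
the first sentence and the defected running, never (0.31) at every k. [cite: Balaban1987RG1, Thm 2 (0.31) p.259] -/
theorem not_theorem2Statement_of_avgAFH :
    ¬ ∀ (S : Setting) (hH : StandingHypotheses S) (γ₀ s D β' : ℝ), Definitions S → Conclusions S → 0 < γ₀ → 0 < s → 0 ≤ β' →
        BetaContH γ₀ S.β → BetaAvgAFH s D γ₀ S.β → BetaUpperH β' γ₀ S.β → Theorem2Statement S (hL_of_standing hH) := by
  intro h
  obtain ⟨S, hH, hD, hC, -, hcar, hnot⟩ := avgAF_carrier_not_theorem2
  obtain ⟨havg, hcont, hup⟩ := hcar 1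
  exact hnot (h S hH 1 1 2 3 hD hC one_pos one_pos (by norm_num) hcont havg hup)

end

end Summit.QuantumFields.BalabanUV.Beta.EriceFlowEnclosureB12AsPrintedAvgAFWitness
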